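import Mathlib

/-!
# Level sets of `C⁰`-close convex functions along rays; minimisers of a perturbed "pizza" profile

CITATION HEADER (lean-in-tree rule 2026-08-18). Source under adjudication: C.-Q. Cheng, J. Xue, *Arnold diffusion
for nearly integrable Hamiltonian systems*, Sci. China Math. **66** (2023) 1649–1712, doi:10.1007/s11425-022-2118-1
(bib key `ChengXue2023`), read in arXiv:1503.04153v5 (`n-diffusion05082019.tex`, 2019-05-08; locators `l.NNNN` = line
numbers of that file, written `:NNNN` in the pub-arnold cell's LEMMAS/GAPS), §6 "the ladder" (Lemma `LmCeqTriple`
l.1706–1719, Lemma `ladder` l.1737–1762, Prop. `pizza` l.1670–1686) and the proof of Prop. `PropAlpha` (l.1217).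
The sentences concerned, verbatim — THESE ARE CLAIMS UNDER ADJUDICATION by the pub-arnold near-miss cell (LEMMAS §3.X
AF7, claim row C46); nothing in this file asserts or uses any statement of the paper as a fact, and nothing here
concerns Hamiltonian systems or α-functions:

* l.1217: "This follows from the following fact about convex functions: given two convex functions α_δ and α_0 with
  |α_δ − α_0|_{C^0} ≤ δ and ‖Dα_0‖ ≥ C > 0 on the level set {α_0(c) = E}, then the level sets {α_δ(c) = E} and
  {α_0(c) = E} are O(δ)-close to each other. To prove this fact, it is enough to measure the distance of the
  intersection points of the two level sets with each radial line. Since the subdifferential Dα is bounded away from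
  zero, to maintain constant E, the distance can at most be O(δ)."  The same fact is used at l.1714–1716 (Lemma
  `LmCeqTriple`: "On Γ_δ(c_3*), we find a point that is closest to (−c̃*, c_3*) and denote it by (c̃♯, c_3*) where
  |c̃♯ + c̃*| ≤ Cδ") and at l.1750 (Lemma `ladder`: "The path 𝕃̄_δ is δ-close to 𝕃̄_0").
* l.1671 (Prop. `pizza`): "the flat 𝔽_0 = {c | α_{𝒢_{3,δ}}(c) = min α_{𝒢_{3,δ}}} is a three dimensional convex set
  lying in a O(√(δ/b_3))-neighborhood of the disk 𝔽̃_0 × {c_3 = 0̂}, where 𝔽̃_0 = Argmin α_{G̃}"; its proof l.1675–1683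
  uses exactly three ingredients — `|α_{𝒢_{3,δ}} − α_{𝒢_{3,0}}|_{C⁰} ≤ δ` (l.1681), `α_{𝒢_{3,0}}(c) = α_{G̃}(c̃) +
  (b_3/2)c_3²` (l.1683), `α_{G̃}` non-negative (l.1683; `min α_{G̃} = 0` by the normalisation `max V = 0`) — and
  establishes "α_{𝒢_{3,δ}}(c) > min α_{𝒢_{3,δ}}, if |c_3| > 2√(δ/b_3)" (l.1683).

WHAT IS PROVED HERE (elementary real analysis from Mathlib alone; every declaration kernel-checked, tagged [folklore]).

§1 Radial level points. For `g : ℝ → ℝ` convex on `[0, ∞)` with `g 0 = a < E`, `g T = E`, `T > 0` — read `g t =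
α_0(z + t·u)` along a ray issued from a point `z` of the sub-level set `{α_0 < E}` — and ANY real function `f`:
* `ray_chord_bound`, `ray_secant_bound`: `g` lies below the chord on `[0, T]` and above the extended secant beyond `T`
  (multiplicative forms, no division);
* `exists_level_pt_near`: if `f` is continuous on `[0, ∞)`, `|f − g| ≤ δ` there and `0 ≤ δ ≤ E − a`, then
  `f t = E` for some `t ≥ 0` with `|t − T| ≤ δ·T/(E − a)` (intermediate values between `T ∓ δT/(E − a)`);
* `level_pt_near`: conversely every `t ≥ 0` with `|g t − E| ≤ δ` — in particular every `E`-level point of such an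
  `f` (`level_pt_near'`) — satisfies `|t − T| ≤ δ·T/(E − a)`; `level_pt_unique`: the `E`-level point of `g` on the
  ray is unique.
Ray by ray from a common centre `z`, the two level sets are therefore within Hausdorff distance `δ·R/(E − a)` of each
other, `R` = the largest radial distance of the unperturbed level set from `z`.  No differentiability of `α_0` and no
a-priori lower bound on a gradient is needed beyond `a < E`: convexity alone forces the radial secant slope to be
`≥ (E − a)/T ≥ (E − a)/R`, which is the usable content of "since the subdifferential Dα is bounded away from zero"
(l.1217).  At l.1716 the two functions live at two level VALUES differing by at most `δ`; subtracting that difference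
from `f` keeps `|f − g| ≤ 2δ`, so the constant there reads `2R/(E_0 − a)`, uniform in the perturbation parameter as
long as the level `E_0` stays boundedly above `a = min α_0`.  Whether these hypotheses are met in the audited text is
for the auditors (cell rows C16/C19), not for this file.

§2 The pizza slab. `abs_le_two_mul_sqrt_of_isMin`: if `|f x y − (a x + (b/2) y²)| ≤ δ` for all `(x, y)`, `a ≥ 0`
with `a x₀ = 0` for some `x₀`, and `b > 0`, then every minimiser `(x, y)` of `f` has `|y| ≤ 2√(δ/b)` — the bound of
l.1676–1683 with the same constant.  `exists_isMin_far`: the HORIZONTAL half of the printed sentence l.1671 does not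
follow from the three ingredients: with `a x = x⁴` (so `Argmin a = {0}`) and `b = 2`, for every `C > 0` there are
`δ > 0`, an admissible `f` and a minimiser `(x, 0)` of `f` with `|x| > C·√(δ/b)` (`δ = s⁴`, `f x y = x⁴ + y² −
min(s⁴, x⁴)`, `x = s = 1/C`).  This is a statement about the abstract implication only (`\ref{pizza}` occurs nowhere
in the v5 source, so nothing downstream depends on the horizontal half).
-/

namespace Literature.Dynamics.Hamiltonian.ChengXue2023

open Set

/-! ## §1 Convex functions along a ray issued from a sub-level point -/

section Ray

variable {g : ℝ → ℝ} {a E T : ℝ}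

/-- [folklore] Chord bound. If `g` is convex on `[0, ∞)`, `g 0 = a`, `g T = E` and
`0 ≤ t ≤ T`, then `T·g t ≤ (T − t)·a + t·E`, i.e. `g t ≤ E − (E − a)(T − t)/T` when `T > 0`. -/
theorem ray_chord_bound (hg : ConvexOn ℝ (Ici (0 : ℝ)) g) (h0 : g 0 = a) (hE : g T = E)
    {t : ℝ} (ht0 : 0 ≤ t) (htT : t ≤ T) : T * g t ≤ (T - t) * a + t * E := by
  rcases ht0.eq_or_lt with h | ht0'
  · subst h
    simp [h0]
  rcases htT.eq_or_lt with h | htT'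
  · subst h
    simp [hE]
  have h := hg.secant_mono_aux1 (x := 0) (y := t) (z := T) (mem_Ici.mpr le_rfl)
    (mem_Ici.mpr (ht0.trans htT)) ht0' htT'
  simpa [h0, hE] using h

/-- [folklore] Secant bound beyond the level point. If `g` is convex on `[0, ∞)`, `g 0 = a`,
`g T = E`, `0 < T ≤ t`, then `T·a + t·(E − a) ≤ T·g t`, i.e. `g t ≥ E + (E − a)(t − T)/T`. -/
theorem ray_secant_bound (hg : ConvexOn ℝ (Ici (0 : ℝ)) g) (h0 : g 0 = a) (hT : 0 < T)
    (hE : g T = E) {t : ℝ} (hTt : T ≤ t) : T * a + t * (E - a) ≤ T * g t := by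
  rcases hTt.eq_or_lt with h | hTt'
  · subst h
    rw [hE]
    exact le_of_eq (by ring)
  have h := hg.secant_mono_aux1 (x := 0) (y := T) (z := t) (mem_Ici.mpr le_rfl)
    (mem_Ici.mpr (hT.le.trans hTt)) hT hTt'
  -- h : (t - 0) * g T ≤ (t - T) * g 0 + (T - 0) * g t
  simp only [sub_zero, h0, hE] at h
  linarith

/-- [folklore] **Radial level points of a `C⁰`-perturbation exist nearby.** `g` convex on
`[0, ∞)` with `g 0 = a < E = g T`, `T > 0`; `f` continuous on `[0, ∞)` with `|f − g| ≤ δ`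
there, `0 ≤ δ ≤ E − a`. Then `f` takes the value `E` at some `t ≥ 0` with
`|t − T| ≤ δ·T/(E − a)` (intermediate value theorem between `T ∓ δT/(E − a)`). -/
theorem exists_level_pt_near (hg : ConvexOn ℝ (Ici (0 : ℝ)) g) (h0 : g 0 = a) (hT : 0 < T)
    (hE : g T = E) (haE : a < E) {f : ℝ → ℝ} {δ : ℝ} (hδ : 0 ≤ δ) (hδE : δ ≤ E - a)
    (hf : ContinuousOn f (Ici (0 : ℝ))) (hfg : ∀ t, 0 ≤ t → |f t - g t| ≤ δ) :
    ∃ t, 0 ≤ t ∧ |t - T| ≤ δ * T / (E - a) ∧ f t = E := by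
  have hEa : 0 < E - a := sub_pos.mpr haE
  have hEa' : E - a ≠ 0 := hEa.ne'
  set s : ℝ := δ * T / (E - a) with hs_def
  have hs0 : 0 ≤ s := by positivity
  have hsT : s ≤ T := by
    rw [hs_def, div_le_iff₀ hEa]
    have := mul_le_mul_of_nonneg_right hδE hT.le
    linarith
  have hs_mul : s * (E - a) = δ * T := by
    rw [hs_def]
    field_simp
  -- the lower point `T - s`
  have h1 : f (T - s) ≤ E := by
    have hc := ray_chord_bound hg h0 hE (t := T - s) (by linarith) (by linarith)
    have hd := (abs_le.mp (hfg (T - s) (by linarith))).2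
    have hg' : T * g (T - s) ≤ T * E - δ * T := by linarith
    have hm := mul_le_mul_of_nonneg_left (show f (T - s) ≤ g (T - s) + δ by linarith) hT.le
    have : T * f (T - s) ≤ T * E := by linarith
    exact le_of_mul_le_mul_left this hT
  -- the upper point `T + s`
  have h2 : E ≤ f (T + s) := by
    have hc := ray_secant_bound hg h0 hT hE (t := T + s) (by linarith)
    have hd := (abs_le.mp (hfg (T + s) (by linarith))).1
    have hg' : T * E + δ * T ≤ T * g (T + s) := by linarith
    have hm := mul_le_mul_of_nonneg_left (show g (T + s) - δ ≤ f (T + s) by linarith) hT.le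
    have : T * E ≤ T * f (T + s) := by linarith
    exact le_of_mul_le_mul_left this hT
  -- intermediate value theorem on `[T - s, T + s] ⊆ [0, ∞)`
  have hcont : ContinuousOn f (Icc (T - s) (T + s)) :=
    hf.mono fun x hx => mem_Ici.mpr (by linarith [hx.1])
  obtain ⟨t, ht, hft⟩ :=
    intermediate_value_Icc (show T - s ≤ T + s by linarith) hcont (mem_Icc.mpr ⟨h1, h2⟩)
  refine ⟨t, by linarith [ht.1], ?_, hft⟩
  exact abs_le.mpr ⟨by linarith [ht.1], by linarith [ht.2]⟩

/-- [folklore] **Converse: every near-level point of the ray is close to the level point.**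
`g` convex on `[0, ∞)`, `g 0 = a < E = g T`, `T > 0`; if `t ≥ 0` and `|g t − E| ≤ δ` then
`|t − T| ≤ δ·T/(E − a)`. (No perturbation `f` appears: apply it to an `E`-level point `t` of any
`f` with `|f t − g t| ≤ δ`, see `level_pt_near'`.) -/
theorem level_pt_near (hg : ConvexOn ℝ (Ici (0 : ℝ)) g) (h0 : g 0 = a) (hT : 0 < T)
    (hE : g T = E) (haE : a < E) {t δ : ℝ} (ht : 0 ≤ t) (hgt : |g t - E| ≤ δ) :
    |t - T| ≤ δ * T / (E - a) := by
  have hEa : 0 < E - a := sub_pos.mpr haE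
  have hδ : 0 ≤ δ := (abs_nonneg _).trans hgt
  obtain ⟨hlo, hhi⟩ := abs_le.mp hgt
  rw [le_div_iff₀ hEa, ← abs_of_pos hEa, ← abs_mul]
  refine abs_le.mpr ⟨?_, ?_⟩
  · rcases le_total t T with htT | hTt
    · have hc := ray_chord_bound hg h0 hE ht htT
      have hm := mul_le_mul_of_nonneg_left hlo hT.le
      linarith
    · nlinarith [hδ, hT.le, hTt, hEa.le]
  · rcases le_total t T with htT | hTt
    · nlinarith [hδ, hT.le, htT, hEa.le]
    · have hc := ray_secant_bound hg h0 hT hE hTt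
      have hm := mul_le_mul_of_nonneg_left hhi hT.le
      linarith

/-- [folklore] The perturbed form of `level_pt_near`: an `E`-level point `t ≥ 0` of a function
`f` with `|f t − g t| ≤ δ` lies within `δ·T/(E − a)` of the level point `T` of `g`. -/
theorem level_pt_near' (hg : ConvexOn ℝ (Ici (0 : ℝ)) g) (h0 : g 0 = a) (hT : 0 < T)
    (hE : g T = E) (haE : a < E) {f : ℝ → ℝ} {t δ : ℝ} (ht : 0 ≤ t) (hfg : |f t - g t| ≤ δ)
    (hft : f t = E) : |t - T| ≤ δ * T / (E - a) := by
  refine level_pt_near hg h0 hT hE haE ht ?_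
  have : g t - E = -(f t - g t) := by rw [hft]; ring
  rw [this, abs_neg]
  exact hfg

/-- [folklore] Uniqueness of the level point on the ray: `g` convex on `[0, ∞)`,
`g 0 = a < E`, `g T = E = g t` with `T > 0`, `t ≥ 0` forces `t = T`. -/
theorem level_pt_unique (hg : ConvexOn ℝ (Ici (0 : ℝ)) g) (h0 : g 0 = a) (hT : 0 < T)
    (hE : g T = E) (haE : a < E) {t : ℝ} (ht : 0 ≤ t) (hgt : g t = E) : t = T := by
  have h := level_pt_near hg h0 hT hE haE ht (δ := 0) (by rw [hgt, sub_self, abs_zero])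
  rw [zero_mul, zero_div] at h
  have := abs_nonneg (t - T)
  have h0' : |t - T| = 0 := le_antisymm h this
  rwa [abs_eq_zero, sub_eq_zero] at h0'

end Ray

/-! ## §2 Minimisers of a `δ`-perturbation of `a(x) + (b/2) y²` -/

section Pizza

/-- [folklore] **The slab bound of l.1676–1683.** If `|f x y − (a x + (b/2) y²)| ≤ δ` for all
`(x, y)`, `a ≥ 0` with `a x₀ = 0` for some `x₀`, and `b > 0`, then every minimiser `(x, y)` of
`f` satisfies `|y| ≤ 2√(δ/b)`. (Indeed `|y| > 2√(δ/b)` gives `a x + (b/2)y² > 2δ`, hence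
`f x y > δ ≥ f x₀ 0`.) -/
theorem abs_le_two_mul_sqrt_of_isMin {X : Type*} {a : X → ℝ} (ha : ∀ x, 0 ≤ a x) {x₀ : X}
    (hx₀ : a x₀ = 0) {b δ : ℝ} (hb : 0 < b) {f : X → ℝ → ℝ}
    (hf : ∀ x y, |f x y - (a x + b / 2 * y ^ 2)| ≤ δ) {x : X} {y : ℝ}
    (hmin : ∀ x' y', f x y ≤ f x' y') : |y| ≤ 2 * Real.sqrt (δ / b) := by
  have hb0 : b ≠ 0 := hb.ne'
  have hδ : 0 ≤ δ := (abs_nonneg _).trans (hf x y)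
  have hq : 0 ≤ δ / b := by positivity
  by_contra h
  push Not at h
  have h2 : 0 ≤ 2 * Real.sqrt (δ / b) := by positivity
  have hsq : (2 * Real.sqrt (δ / b)) * (2 * Real.sqrt (δ / b)) < |y| * |y| :=
    mul_self_lt_mul_self h2 h
  have e1 : (2 * Real.sqrt (δ / b)) * (2 * Real.sqrt (δ / b)) = 4 * (δ / b) := by
    rw [show (2 * Real.sqrt (δ / b)) * (2 * Real.sqrt (δ / b))
        = 4 * (Real.sqrt (δ / b) * Real.sqrt (δ / b)) by ring, Real.mul_self_sqrt hq]
  have e2 : |y| * |y| = y ^ 2 := by rw [abs_mul_abs_self, sq]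
  rw [e1, e2] at hsq
  have e3 : b / 2 * (4 * (δ / b)) = 2 * δ := by
    field_simp
    ring
  have hg : 2 * δ < a x + b / 2 * y ^ 2 := by
    have : b / 2 * (4 * (δ / b)) < b / 2 * y ^ 2 := mul_lt_mul_of_pos_left hsq (by positivity)
    rw [e3] at this
    linarith [ha x]
  have h1 : δ < f x y := by linarith [(abs_le.mp (hf x y)).1]
  have h0 : f x₀ 0 ≤ δ := by
    have := (abs_le.mp (hf x₀ 0)).2
    rw [hx₀] at this
    norm_num at this
    exact this
  linarith [hmin x₀ 0]

/-- [folklore] **The horizontal half of l.1671 does not follow from the ingredients of its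
proof.** Take `a x = x⁴` (so `a ≥ 0`, `Argmin a = {0}`) and `b = 2`. For every `C > 0` there
are `δ > 0`, a function `f` with `|f x y − (x⁴ + (2/2) y²)| ≤ δ` everywhere, and a minimiser
`(x, 0)` of `f` with `|x| > C·√(δ/2)`: `δ = s⁴`, `f x y = x⁴ + y² − min(s⁴, x⁴)`, `x = s = 1/C`.
So `C⁰`-`δ`-closeness to `a(x) + (b/2)y²` confines minimisers to the slab `|y| ≤ 2√(δ/b)`
(`abs_le_two_mul_sqrt_of_isMin`) but NOT to an `O(√(δ/b))`-neighbourhood of `Argmin a × {0}`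
in the `x`-direction; any horizontal rate needs a growth modulus of `a` off its minimum set. -/
theorem exists_isMin_far (C : ℝ) (hC : 0 < C) :
    ∃ (δ : ℝ) (f : ℝ → ℝ → ℝ) (x : ℝ), 0 < δ ∧
      (∀ x' y', |f x' y' - (x' ^ 4 + (2 : ℝ) / 2 * y' ^ 2)| ≤ δ) ∧
      (∀ x' y', f x 0 ≤ f x' y') ∧ C * Real.sqrt (δ / 2) < |x| := by
  have hC0 : C ≠ 0 := hC.ne'
  set s : ℝ := 1 / C with hs
  have hs0 : 0 < s := by positivity
  refine ⟨s ^ 4, fun x' y' => x' ^ 4 + y' ^ 2 - min (s ^ 4) (x' ^ 4), s, by positivity,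
    ?_, ?_, ?_⟩
  · intro x' y'
    beta_reduce
    have h1 : min (s ^ 4) (x' ^ 4) ≤ s ^ 4 := min_le_left _ _
    have h2 : 0 ≤ min (s ^ 4) (x' ^ 4) := le_min (by positivity) (by positivity)
    rw [abs_le]
    constructor <;> linarith
  · intro x' y'
    beta_reduce
    have h3 : min (s ^ 4) (x' ^ 4) ≤ x' ^ 4 := min_le_right _ _
    simp only [min_self]
    linarith [sq_nonneg y']
  · have h4 : Real.sqrt (s ^ 4 / 2) < s ^ 2 := by
      rw [show s ^ 2 = Real.sqrt ((s ^ 2) ^ 2) from (Real.sqrt_sq (by positivity)).symm]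
      apply Real.sqrt_lt_sqrt (by positivity)
      linarith [pow_pos hs0 4]
    have h5 : C * s = 1 := by
      rw [hs]
      exact mul_one_div_cancel hC0
    rw [abs_of_pos hs0]
    calc C * Real.sqrt (s ^ 4 / 2) < C * s ^ 2 := mul_lt_mul_of_pos_left h4 hC
      _ = (C * s) * s := by ring
      _ = s := by rw [h5, one_mul]

end Pizza

end Literature.Dynamics.Hamiltonian.ChengXue2023
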